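import Summits.AtomisticToContinuum.HydrodynamicLimit.Theses.InformationPercolationEngine
import Literature.MathematicalPhysics.KineticTheory.TaggedSphereCarleman
import Literature.Probability.Distributions.GaussianSphereMarginal
import Summits.AtomisticToContinuum.HydrodynamicLimit.Theorems.SpectralContractionR.Negative.WithoutMeanZero
import Summits.AtomisticToContinuum.HydrodynamicLimit.Theorems.SpectralContractionR.Negative.WithoutMeasurable

/-!
# Spike sums under the Carleman kernel (towards `SpectralContractionR` without integrability, 1/3)

First of three files refuting `SpectralContractionRWithoutIntegrable` — the crux
`InformationPercolationEngine.SpectralContractionR` (stmt-AtomisticToContinuum-13913) with its hypothesis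
`Integrable (f² νM)` deleted (standing disprover refuter-cdisprove-stmt-AtomisticToContinuum-13913-0; see
`Negative/WithoutIntegrable.lean` for the statement and the assembled refutation).

This file: in `d = 3` the Carleman kernel at `β = 1` is dominated by the Newtonian kernel,
`k₁(v, u) ≤ (2π)^{-1/2} |u|⁻¹` (`carlemanKernel_one_le`); the Newtonian kernel has mass `≤ 4 |B₁| r²` on every
ball of radius `r` (`lintegral_inv_norm_ball_le`, polar coordinates via `lintegral_fun_norm_addHaar`); hence the
radial spike sum `G = Σ_n a_n 1_{B(0, r_n)}`, `a_n = 2^{7(n+1)}`, `r_n = 2^{-4(n+1)}` (so `a_n r_n² = 2^{-(n+1)}`,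
`a_n r_n³ = 2^{-5(n+1)}`, `a_n² r_n³ = 2^{2(n+1)}`) satisfies the UNIFORM Carleman bound
`∫ k₁(v, u) G(v + u) du ≤ 4 (2π)^{-1/2} |B₁|` (`lintegral_carlemanKernel_mul_G_le`): `K g` is bounded although
`g = G.toReal ∉ L²`.
-/

noncomputable section

open MeasureTheory Metric Real Set Filter Topology ProbabilityTheory
open scoped InnerProductSpace ENNReal

namespace Summit.AtomisticToContinuum.HydrodynamicLimit.Theorems

namespace SpectralContractionRWithoutIntegrable

open Literature.MathematicalPhysics.KineticTheory
open Literature.Analysis.FunctionSpaces (maxwellianBeta maxwellianBeta_one maxwellianBeta_pos)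
open Literature.Analysis.FluidPDE (globalMaxwellian globalMaxwellian_pos)

/-- The Gaussian density is bounded by its peak. [folklore] -/
theorem gaussianPDFReal_le_peak (μ : ℝ) (x : ℝ) :
    gaussianPDFReal μ 1 x ≤ (Real.sqrt (2 * Real.pi))⁻¹ := by
  rw [gaussianPDFReal]
  have h1 : Real.exp (-(x - μ) ^ 2 / (2 * ((1 : NNReal) : ℝ))) ≤ 1 := by
    rw [Real.exp_le_one_iff]
    apply div_nonpos_of_nonpos_of_nonneg
    · nlinarith [sq_nonneg (x - μ)]
    · norm_num
  have h0 : 0 ≤ (Real.sqrt (2 * Real.pi * ((1 : NNReal) : ℝ)))⁻¹ := inv_nonneg.2 (Real.sqrt_nonneg _)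
  calc (Real.sqrt (2 * Real.pi * ((1 : NNReal) : ℝ)))⁻¹ * Real.exp (-(x - μ) ^ 2 / (2 * ((1 : NNReal) : ℝ)))
      ≤ (Real.sqrt (2 * Real.pi * ((1 : NNReal) : ℝ)))⁻¹ * 1 := mul_le_mul_of_nonneg_left h1 h0
    _ = (Real.sqrt (2 * Real.pi))⁻¹ := by simp

/-- In `d = 3` the Carleman kernel at `β = 1` is dominated by the Newtonian kernel:
`k₁(v, u) ≤ (2π)^{-1/2} ‖u‖⁻¹`. [folklore] -/
theorem carlemanKernel_one_le (v u : V3) :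
    carlemanKernel 1 v u ≤ (Real.sqrt (2 * Real.pi))⁻¹ * ‖u‖⁻¹ := by
  rw [carlemanKernel]
  have hcard : Fintype.card (Fin 3) - 2 = 1 := by simp
  rw [hcard, pow_one, mul_comm]
  have h1 : ((1 : ℝ)⁻¹).toNNReal = 1 := by simp
  rw [h1]
  exact mul_le_mul_of_nonneg_right (gaussianPDFReal_le_peak _ _) (inv_nonneg.2 (norm_nonneg _))

/-- `∫_{|u| < r} |u|⁻¹ du ≤ 3 |B₁| r²` in `ℝ³` (polar coordinates). [folklore] -/
theorem lintegral_inv_norm_ball_zero_le {r : ℝ} (hr : 0 < r) :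
    ∫⁻ u in ball (0 : V3) r, ENNReal.ofReal (‖u‖⁻¹) ≤
      3 * volume (ball (0 : V3) 1) * ENNReal.ofReal (r ^ 2) := by
  set f : ℝ → ℝ≥0∞ := fun y => (Iio r).indicator (fun y => ENNReal.ofReal (y⁻¹)) y with hf
  have hfm : Measurable f := (ENNReal.measurable_ofReal.comp measurable_inv).indicator measurableSet_Iio
  have hind : ∫⁻ u in ball (0 : V3) r, ENNReal.ofReal (‖u‖⁻¹) = ∫⁻ u : V3, f ‖u‖ := by
    rw [← lintegral_indicator measurableSet_ball]
    refine lintegral_congr fun u => ?_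
    simp only [hf, Set.indicator, mem_ball_zero_iff, Set.mem_Iio]
  rw [hind, Literature.Probability.Distributions.lintegral_fun_norm_addHaar volume f hfm,
    finrank_euclideanSpace_fin]
  have h31 : (3 : ℕ) - 1 = 2 := by norm_num
  rw [h31]
  have h1 : ∫⁻ y in Ioi (0 : ℝ), ENNReal.ofReal (y ^ 2) * f y ≤
      ∫⁻ y in Ioi (0 : ℝ), (Iio r).indicator (fun _ => ENNReal.ofReal r) y := by
    refine setLIntegral_mono' measurableSet_Ioi fun y hy => ?_
    have hy0 : 0 < y := hy
    simp only [hf, Set.indicator, Set.mem_Iio]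
    split_ifs with hyr
    · rw [← ENNReal.ofReal_mul (sq_nonneg y)]
      apply ENNReal.ofReal_le_ofReal
      have : y ^ 2 * y⁻¹ = y := by field_simp
      rw [this]; exact hyr.le
    · simp
  have h2 : ∫⁻ y in Ioi (0 : ℝ), (Iio r).indicator (fun _ => ENNReal.ofReal r) y =
      ENNReal.ofReal r * ENNReal.ofReal r := by
    rw [lintegral_indicator measurableSet_Iio, setLIntegral_const, Measure.restrict_apply measurableSet_Iio]
    have : Iio r ∩ Ioi 0 = Ioo 0 r := by
      ext y; simp [and_comm]
    rw [this, Real.volume_Ioo, sub_zero]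
  calc ((3 : ℕ) : ℝ≥0∞) * volume (ball (0 : V3) 1) * ∫⁻ y in Ioi (0 : ℝ), ENNReal.ofReal (y ^ 2) * f y
      ≤ 3 * volume (ball (0 : V3) 1) * (ENNReal.ofReal r * ENNReal.ofReal r) := by
        rw [← h2]; push_cast; exact mul_le_mul_right h1 _
    _ = 3 * volume (ball (0 : V3) 1) * ENNReal.ofReal (r ^ 2) := by
        rw [← ENNReal.ofReal_mul hr.le, sq]

/-- `∫_{B(c, r)} |u|⁻¹ du ≤ 4 |B₁| r²` in `ℝ³`, uniformly in the centre. [folklore] -/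
theorem lintegral_inv_norm_ball_le (c : V3) {r : ℝ} (hr : 0 < r) :
    ∫⁻ u in ball c r, ENNReal.ofReal (‖u‖⁻¹) ≤
      4 * volume (ball (0 : V3) 1) * ENNReal.ofReal (r ^ 2) := by
  have hpt : ∀ u : V3, ENNReal.ofReal (‖u‖⁻¹) ≤
      (ball (0 : V3) r).indicator (fun u => ENNReal.ofReal (‖u‖⁻¹)) u + ENNReal.ofReal (r⁻¹) := by
    intro u
    by_cases hu : u ∈ ball (0 : V3) r
    · rw [Set.indicator_of_mem hu]; exact le_self_add
    · rw [Set.indicator_of_notMem hu, zero_add]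
      apply ENNReal.ofReal_le_ofReal
      rw [mem_ball_zero_iff, not_lt] at hu
      exact inv_anti₀ hr hu
  calc ∫⁻ u in ball c r, ENNReal.ofReal (‖u‖⁻¹)
      ≤ ∫⁻ u in ball c r, ((ball (0 : V3) r).indicator (fun u => ENNReal.ofReal (‖u‖⁻¹)) u +
          ENNReal.ofReal (r⁻¹)) := lintegral_mono fun u => hpt u
    _ = (∫⁻ u in ball c r, (ball (0 : V3) r).indicator (fun u => ENNReal.ofReal (‖u‖⁻¹)) u) +
          ∫⁻ _ in ball c r, ENNReal.ofReal (r⁻¹) := by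
        rw [lintegral_add_right _ measurable_const]
    _ ≤ (∫⁻ u, (ball (0 : V3) r).indicator (fun u => ENNReal.ofReal (‖u‖⁻¹)) u) +
          ENNReal.ofReal (r⁻¹) * volume (ball c r) := by
        gcongr
        · exact Measure.restrict_le_self
        · rw [setLIntegral_const]
    _ ≤ 3 * volume (ball (0 : V3) 1) * ENNReal.ofReal (r ^ 2) +
          volume (ball (0 : V3) 1) * ENNReal.ofReal (r ^ 2) := by
        have hA : (∫⁻ u, (ball (0 : V3) r).indicator (fun u => ENNReal.ofReal (‖u‖⁻¹)) u) ≤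
            3 * volume (ball (0 : V3) 1) * ENNReal.ofReal (r ^ 2) := by
          rw [lintegral_indicator measurableSet_ball]
          exact lintegral_inv_norm_ball_zero_le hr
        have hB : ENNReal.ofReal (r⁻¹) * volume (ball c r) =
            volume (ball (0 : V3) 1) * ENNReal.ofReal (r ^ 2) := by
          rw [Measure.addHaar_ball volume c hr.le, finrank_euclideanSpace_fin, ← mul_assoc,
            ← ENNReal.ofReal_mul (inv_nonneg.2 hr.le), mul_comm]
          congr 2
          field_simp
        exact add_le_add hA hB.le
    _ = 4 * volume (ball (0 : V3) 1) * ENNReal.ofReal (r ^ 2) := by ring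


/-! ### The witness: a radial sum of spikes `g = Σ 2^{7(n+1)} 1_{|x| < 2^{-4(n+1)}}` -/

/-- Radii `r_n = 2^{-4(n+1)}`. -/
def rad (n : ℕ) : ℝ := (2⁻¹ : ℝ) ^ (4 * (n + 1))

/-- Heights `a_n = 2^{7(n+1)}` (as reals). -/
def ampR (n : ℕ) : ℝ := (2 : ℝ) ^ (7 * (n + 1))

/-- `r_n > 0`. [folklore] -/
theorem rad_pos (n : ℕ) : 0 < rad n := by unfold rad; positivity

/-- `a_n > 0`. [folklore] -/
theorem ampR_pos (n : ℕ) : 0 < ampR n := by unfold ampR; positivity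

/-- `r_n ≤ 1`: all spikes sit in the unit ball. [folklore] -/
theorem rad_le_one (n : ℕ) : rad n ≤ 1 := by
  unfold rad; exact pow_le_one₀ (by norm_num) (by norm_num)

/-- `a_n r_n² = 2^{-(n+1)}` (summable: `K g` is bounded). [folklore] -/
theorem ampR_mul_rad_sq (n : ℕ) : ampR n * rad n ^ 2 = (2⁻¹ : ℝ) ^ (n + 1) := by
  unfold ampR rad
  rw [← pow_mul, show 4 * (n + 1) * 2 = 7 * (n + 1) + (n + 1) by ring, pow_add, inv_pow, inv_pow,
    ← mul_assoc, mul_inv_cancel₀ (pow_ne_zero _ two_ne_zero), one_mul]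

/-- `a_n r_n³ = 2^{-5(n+1)}` (summable: `g ∈ L¹`). [folklore] -/
theorem ampR_mul_rad_cube (n : ℕ) : ampR n * rad n ^ 3 = (2⁻¹ : ℝ) ^ (5 * (n + 1)) := by
  unfold ampR rad
  rw [← pow_mul, show 4 * (n + 1) * 3 = 7 * (n + 1) + 5 * (n + 1) by ring, pow_add, inv_pow, inv_pow,
    ← mul_assoc, mul_inv_cancel₀ (pow_ne_zero _ two_ne_zero), one_mul]

/-- `a_n² r_n³ = 2^{2(n+1)}` (NOT summable: `g ∉ L²`). [folklore] -/
theorem ampR_sq_mul_rad_cube (n : ℕ) : ampR n ^ 2 * rad n ^ 3 = (2 : ℝ) ^ (2 * (n + 1)) := by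
  unfold ampR rad
  rw [← pow_mul, ← pow_mul, show 7 * (n + 1) * 2 = 2 * (n + 1) + 4 * (n + 1) * 3 by ring, pow_add,
    inv_pow, mul_assoc, mul_inv_cancel₀ (pow_ne_zero _ two_ne_zero), mul_one]

/-- The `ℝ≥0∞`-valued spike sum `G = Σ_n a_n 1_{B(0, r_n)}`. -/
def G (x : V3) : ℝ≥0∞ := ∑' n, (ball (0 : V3) (rad n)).indicator (fun _ => ENNReal.ofReal (ampR n)) x

/-- The witness profile `g = G.toReal` (finite off the origin). -/
def g (x : V3) : ℝ := (G x).toReal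

/-- `G` is measurable (countable sum of indicators). [folklore] -/
theorem measurable_G : Measurable G :=
  Measurable.tsum fun _ => measurable_const.indicator measurableSet_ball

/-- `g` is measurable. [folklore] -/
theorem measurable_g : Measurable g := measurable_G.ennreal_toReal

/-- `g ≥ 0`. [folklore] -/
theorem g_nonneg (x : V3) : 0 ≤ g x := ENNReal.toReal_nonneg

/-- Off the origin only finitely many spikes are seen, so `G x < ∞`. [folklore] -/
theorem G_lt_top {x : V3} (hx : x ≠ 0) : G x < ∞ := by
  have hxpos : 0 < ‖x‖ := norm_pos_iff.2 hx
  -- choose N with r_N ≤ ‖x‖ for all n ≥ N (indeed r_n ≤ 2^{-(n+1)} → 0)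
  obtain ⟨N, hN⟩ : ∃ N : ℕ, (2⁻¹ : ℝ) ^ N < ‖x‖ := exists_pow_lt_of_lt_one hxpos (by norm_num)
  have hzero : ∀ n ∉ Finset.range N,
      (ball (0 : V3) (rad n)).indicator (fun _ => ENNReal.ofReal (ampR n)) x = 0 := by
    intro n hn
    rw [Finset.mem_range, not_lt] at hn
    apply Set.indicator_of_notMem
    rw [mem_ball_zero_iff, not_lt]
    calc rad n = (2⁻¹ : ℝ) ^ (4 * (n + 1)) := rfl
      _ ≤ (2⁻¹ : ℝ) ^ N := pow_le_pow_of_le_one (by norm_num) (by norm_num) (by omega)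
      _ ≤ ‖x‖ := hN.le
  unfold G
  rw [tsum_eq_sum hzero]
  exact ENNReal.sum_lt_top.2 fun n _ => by
    by_cases h : x ∈ ball (0 : V3) (rad n)
    · rw [Set.indicator_of_mem h]; exact ENNReal.ofReal_lt_top
    · rw [Set.indicator_of_notMem h]; exact ENNReal.zero_lt_top

/-- Inside the `N`-th ball the profile is at least `a_N`. [folklore] -/
theorem ampR_le_g {x : V3} (hx : x ≠ 0) {N : ℕ} (hxN : x ∈ ball (0 : V3) (rad N)) :
    ampR N ≤ g x := by
  have h1 : ENNReal.ofReal (ampR N) ≤ G x := by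
    unfold G
    calc ENNReal.ofReal (ampR N)
        = (ball (0 : V3) (rad N)).indicator (fun _ => ENNReal.ofReal (ampR N)) x := by
          rw [Set.indicator_of_mem hxN]
      _ ≤ ∑' n, (ball (0 : V3) (rad n)).indicator (fun _ => ENNReal.ofReal (ampR n)) x :=
          ENNReal.le_tsum N
  unfold g
  rw [← ENNReal.ofReal_le_iff_le_toReal (G_lt_top hx).ne]
  exact h1

/-- Off the origin `g` and `G` agree. [folklore] -/
theorem ofReal_g {x : V3} (hx : x ≠ 0) : ENNReal.ofReal (g x) = G x := by
  unfold g; exact ENNReal.ofReal_toReal (G_lt_top hx).ne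

/-- **Tonelli for the spike sum**: `∫ G · W = Σ a_n ∫_{B(0,r_n)} W`. [folklore] -/
theorem lintegral_G_mul {W : V3 → ℝ≥0∞} (hW : Measurable W) (μ : Measure V3) :
    ∫⁻ x, G x * W x ∂μ = ∑' n, ENNReal.ofReal (ampR n) * ∫⁻ x in ball (0 : V3) (rad n), W x ∂μ := by
  unfold G
  simp_rw [← ENNReal.tsum_mul_right]
  rw [lintegral_tsum fun n => show AEMeasurable (fun x => (ball (0 : V3) (rad n)).indicator
      (fun _ => ENNReal.ofReal (ampR n)) x * W x) μ from
    ((measurable_const.indicator measurableSet_ball).mul hW).aemeasurable]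
  refine tsum_congr fun n => ?_
  rw [← lintegral_indicator measurableSet_ball, ← lintegral_const_mul _ (hW.indicator measurableSet_ball)]
  refine lintegral_congr fun x => ?_
  by_cases h : x ∈ ball (0 : V3) (rad n)
  · rw [Set.indicator_of_mem h, Set.indicator_of_mem h]
  · rw [Set.indicator_of_notMem h, Set.indicator_of_notMem h, zero_mul, mul_zero]

/-- `Σ_{n ≥ 0} 2^{-(n+1)} = 1` in `ℝ≥0∞`. [folklore] -/
theorem tsum_ofReal_half_pow_succ : ∑' n : ℕ, ENNReal.ofReal ((2⁻¹ : ℝ) ^ (n + 1)) = 1 := by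
  have h : ∀ n : ℕ, ENNReal.ofReal ((2⁻¹ : ℝ) ^ (n + 1)) = (2⁻¹ : ℝ≥0∞) ^ (n + 1) := by
    intro n
    rw [ENNReal.ofReal_pow (by norm_num), ENNReal.ofReal_inv_of_pos (by norm_num), ENNReal.ofReal_ofNat]
  simp_rw [h, pow_succ', ENNReal.tsum_mul_left, ENNReal.tsum_geometric, ENNReal.one_sub_inv_two, inv_inv]
  exact ENNReal.inv_mul_cancel (by norm_num) (by norm_num)

/-- **The Carleman bound**: `∫ k₁(v, u) G(v + u) du ≤ 4 (2π)^{-1/2} |B₁| Σ a_n r_n² = 4 (2π)^{-1/2} |B₁|`,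
uniformly in `v` — so `K g` is BOUNDED although `g ∉ L²`. [folklore] -/
theorem lintegral_carlemanKernel_mul_G_le (v : V3) :
    ∫⁻ u, ENNReal.ofReal (carlemanKernel 1 v u) * G (v + u) ≤
      ENNReal.ofReal ((Real.sqrt (2 * Real.pi))⁻¹) * (4 * volume (ball (0 : V3) 1)) := by
  -- Tonelli in the form `∫ k(v,u) G(v+u) du = Σ a_n ∫_{v+u ∈ B(0,r_n)} k(v,u) du`
  have hmeas : Measurable fun u : V3 => G (v + u) := measurable_G.comp (measurable_const.add measurable_id)
  have hswap : ∫⁻ u, ENNReal.ofReal (carlemanKernel 1 v u) * G (v + u) =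
      ∫⁻ u, G (v + u) * ENNReal.ofReal (carlemanKernel 1 v u) := lintegral_congr fun u => mul_comm _ _
  rw [hswap]
  have hG : ∀ u : V3, G (v + u) =
      ∑' n, (ball (-v : V3) (rad n)).indicator (fun _ => ENNReal.ofReal (ampR n)) u := by
    intro u
    unfold G
    refine tsum_congr fun n => ?_
    have hiff : v + u ∈ ball (0 : V3) (rad n) ↔ u ∈ ball (-v : V3) (rad n) := by
      rw [mem_ball_zero_iff, mem_ball, dist_eq_norm, sub_neg_eq_add, add_comm]
    by_cases h : v + u ∈ ball (0 : V3) (rad n)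
    · rw [Set.indicator_of_mem h, Set.indicator_of_mem (hiff.1 h)]
    · rw [Set.indicator_of_notMem h, Set.indicator_of_notMem (fun h' => h (hiff.2 h'))]
  simp_rw [hG, ← ENNReal.tsum_mul_right]
  rw [lintegral_tsum fun n => show AEMeasurable (fun u => (ball (-v : V3) (rad n)).indicator
      (fun _ => ENNReal.ofReal (ampR n)) u * ENNReal.ofReal (carlemanKernel 1 v u)) volume from
    ((measurable_const.indicator measurableSet_ball).mul
      (measurable_carlemanKernel_right 1 v).ennreal_ofReal).aemeasurable]
  -- termwise bound
  have hterm : ∀ n, ∫⁻ u, (ball (-v : V3) (rad n)).indicator (fun _ => ENNReal.ofReal (ampR n)) u *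
      ENNReal.ofReal (carlemanKernel 1 v u) ≤
      ENNReal.ofReal ((Real.sqrt (2 * Real.pi))⁻¹) * (4 * volume (ball (0 : V3) 1)) *
        ENNReal.ofReal ((2⁻¹ : ℝ) ^ (n + 1)) := by
    intro n
    have h1 : ∫⁻ u, (ball (-v : V3) (rad n)).indicator (fun _ => ENNReal.ofReal (ampR n)) u *
        ENNReal.ofReal (carlemanKernel 1 v u) =
        ENNReal.ofReal (ampR n) * ∫⁻ u in ball (-v : V3) (rad n), ENNReal.ofReal (carlemanKernel 1 v u) := by
      rw [← lintegral_indicator measurableSet_ball,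
        ← lintegral_const_mul _ ((measurable_carlemanKernel_right 1 v).ennreal_ofReal.indicator
          measurableSet_ball)]
      refine lintegral_congr fun u => ?_
      by_cases h : u ∈ ball (-v : V3) (rad n)
      · rw [Set.indicator_of_mem h, Set.indicator_of_mem h]
      · rw [Set.indicator_of_notMem h, Set.indicator_of_notMem h, zero_mul, mul_zero]
    have h2 : ∫⁻ u in ball (-v : V3) (rad n), ENNReal.ofReal (carlemanKernel 1 v u) ≤
        ENNReal.ofReal ((Real.sqrt (2 * Real.pi))⁻¹) * (4 * volume (ball (0 : V3) 1) *
          ENNReal.ofReal (rad n ^ 2)) := by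
      calc ∫⁻ u in ball (-v : V3) (rad n), ENNReal.ofReal (carlemanKernel 1 v u)
          ≤ ∫⁻ u in ball (-v : V3) (rad n), ENNReal.ofReal ((Real.sqrt (2 * Real.pi))⁻¹) *
              ENNReal.ofReal (‖u‖⁻¹) := by
            refine lintegral_mono fun u => ?_
            rw [← ENNReal.ofReal_mul (inv_nonneg.2 (Real.sqrt_nonneg _))]
            exact ENNReal.ofReal_le_ofReal (carlemanKernel_one_le v u)
        _ = ENNReal.ofReal ((Real.sqrt (2 * Real.pi))⁻¹) *
              ∫⁻ u in ball (-v : V3) (rad n), ENNReal.ofReal (‖u‖⁻¹) := by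
            rw [lintegral_const_mul _ (show Measurable (fun u : V3 => ENNReal.ofReal (‖u‖⁻¹)) from
              measurable_norm.inv.ennreal_ofReal)]
        _ ≤ ENNReal.ofReal ((Real.sqrt (2 * Real.pi))⁻¹) * (4 * volume (ball (0 : V3) 1) *
              ENNReal.ofReal (rad n ^ 2)) :=
            mul_le_mul_right (lintegral_inv_norm_ball_le (-v) (rad_pos n)) _
    rw [h1]
    calc ENNReal.ofReal (ampR n) * ∫⁻ u in ball (-v : V3) (rad n), ENNReal.ofReal (carlemanKernel 1 v u)
        ≤ ENNReal.ofReal (ampR n) * (ENNReal.ofReal ((Real.sqrt (2 * Real.pi))⁻¹) *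
            (4 * volume (ball (0 : V3) 1) * ENNReal.ofReal (rad n ^ 2))) := mul_le_mul_right h2 _
      _ = ENNReal.ofReal ((Real.sqrt (2 * Real.pi))⁻¹) * (4 * volume (ball (0 : V3) 1)) *
            (ENNReal.ofReal (ampR n) * ENNReal.ofReal (rad n ^ 2)) := by ring
      _ = ENNReal.ofReal ((Real.sqrt (2 * Real.pi))⁻¹) * (4 * volume (ball (0 : V3) 1)) *
            ENNReal.ofReal ((2⁻¹ : ℝ) ^ (n + 1)) := by
          rw [← ENNReal.ofReal_mul (ampR_pos n).le, ampR_mul_rad_sq]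
  calc ∑' n, ∫⁻ u, (ball (-v : V3) (rad n)).indicator (fun _ => ENNReal.ofReal (ampR n)) u *
        ENNReal.ofReal (carlemanKernel 1 v u)
      ≤ ∑' n, ENNReal.ofReal ((Real.sqrt (2 * Real.pi))⁻¹) * (4 * volume (ball (0 : V3) 1)) *
          ENNReal.ofReal ((2⁻¹ : ℝ) ^ (n + 1)) := ENNReal.tsum_le_tsum hterm
    _ = ENNReal.ofReal ((Real.sqrt (2 * Real.pi))⁻¹) * (4 * volume (ball (0 : V3) 1)) *
          ∑' n : ℕ, ENNReal.ofReal ((2⁻¹ : ℝ) ^ (n + 1)) := ENNReal.tsum_mul_left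
    _ = ENNReal.ofReal ((Real.sqrt (2 * Real.pi))⁻¹) * (4 * volume (ball (0 : V3) 1)) * 1 := by
        rw [tsum_ofReal_half_pow_succ]
    _ = _ := mul_one _



end SpectralContractionRWithoutIntegrable

end Summit.AtomisticToContinuum.HydrodynamicLimit.Theorems

end
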